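import Summits.Parity.BatemanHorn.Theses.SelbergLift
import Literature.NumberTheory.Sieve.BatemanHornProofs
import Literature.NumberTheory.Sieve.ParityBarrierProofs

/-!
# Birth skeleton (BC3) — crux `LambdaTwoLift` of route `SelbergLift` (item stmt-Parity-18412)

Line `birth`: the **μ ⋆ log² (Type-I + cofactor tail) line** for the one-coordinate Λ₂-lift.

Selberg's identity `Λ(m) log m + Σ_{ab=m} Λ(a)Λ(b) = Λ₂(m) = Σ_{d ∣ m} μ(d) log²(m/d)` (tree:
`generalizedVonMangoldt_succ_apply`, `generalizedVonMangoldt_apply`) turns the crux's sum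
`Ψ₂(x) = Σ_{n ≤ x} Λ₂(f_i(n)) ∏_{j ≠ i} Λ(f_j(n))` into a divisor sum over `d ∣ f_i(n)`, which is cut
by the size of `d` against the level `x^θ` (`0 < θ < 1/2`, the Bombieri–Vinogradov range) and, beyond the
level, by the size of the COFACTOR `e = f_i(n)/d` against `x^τ` (`0 < τ < 1`):

* `stub_typeI_main` — the level-`θ` Type-I main term carries the WHOLE expected mass
  `2 · deg f_i · C(f) · x log x` (singular-series evaluation of `Σ_{d ≤ x^θ} μ(d)ρ_i(d)h(d)/d · log²`;
  provable now for `k = 1` and for a linear partner, the co-system's Bateman–Horn-on-average otherwise);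
* `stub_small_cofactor` — beyond the level, divisors with SMALL cofactor `e ≤ x^τ` contribute
  `o(x log x)`: log²-damped Möbius cancellation of the large divisor along the `e`-derived family
  `f_i(ν + e m)/e` on average over `(e, ν)` (the atom `e = 1` has weight `log² 1 = 0`);
* `stub_large_cofactor` — for SOME admissible `(θ, τ)` the both-large stratum `x^θ < d`, `e > x^τ`
  contributes `o(x log x)` (empty for a linear member once `θ + τ ≥ 1`; the balanced window
  `d ≍ e ≍ x` for a quadratic member; a genuine large stratum for `deg f_i ≥ 3`).

`LambdaTwoLift_of` assembles the crux BY NAME from the three stubs; the assembly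
(`lambdaTwoLift_of_pieces`: identity, trichotomy of the divisor sum, `C(f) > 0`, `deg f_i ≥ 1`,
`IsEquivalent.add_isLittleO`) is kernel-checked and sorry-free.
-/

namespace Summit.Parity.BatemanHorn.Cruxes.LambdaTwoLift.Birth

open scoped ArithmeticFunction.vonMangoldt ArithmeticFunction.Moebius

/-! ## Stubs (the open sub-goals of the line) -/

/-- **Stub 1 — Type-I main term at level `θ < 1/2`.** For every Bateman–Horn system `f`, index `i`
and `0 < θ < 1/2`:
`Σ_{n ≤ x} (Σ_{d ∣ f_i(n), d ≤ x^θ} μ(d) log²(f_i(n)/d)) · ∏_{j≠i} Λ(f_j(n)) ~ 2 · deg f_i · C(f) · x log x`.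
Why plausible: root classes of `f_i` mod `d ≤ x^θ` equidistribute among `n ≤ x`; the co-weights are
distributed in them at Bombieri–Vinogradov level; the singular series
`Σ_d μ(d)ρ_i(d)h(d)/d · log²(x^deg/d)` evaluates to `2 deg · C(f) · log x + O(1)` for every fixed θ
(PNT for `ρ_i` with rate: tree `abs_logRieszMean_moebius_rootCount_sub_batemanHornConst_le`). -/
theorem stub_typeI_main :
    ∀ (k : ℕ) (f : Fin k → Polynomial ℤ) (i : Fin k),
      Literature.NumberTheory.Sieve.IsBatemanHornSystem f →
      ∀ θ : ℝ, 0 < θ → θ < 1 / 2 →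
        Asymptotics.IsEquivalent Filter.atTop
          (fun x : ℕ => ∑ n ∈ Finset.Icc 1 x,
            (∑ d ∈ (((f i).eval (n : ℤ)).toNat).divisors,
              if (d : ℝ) ≤ (x : ℝ) ^ θ then
                ((ArithmeticFunction.moebius d : ℤ) : ℝ) *
                  Real.log ((((f i).eval (n : ℤ)).toNat / d : ℕ) : ℝ) ^ 2
              else 0) *
            ∏ j ∈ Finset.univ.erase i, ArithmeticFunction.vonMangoldt (((f j).eval (n : ℤ)).toNat))
          (fun x : ℕ => 2 * ((f i).natDegree : ℝ) *
            Literature.NumberTheory.Sieve.batemanHornConst f * (x : ℝ) * Real.log x) := by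
  sorry

/-- **Stub 2 — small-cofactor tail (log²-damped Möbius average over the derived family).** For every
Bateman–Horn system `f`, index `i`, `0 < θ < 1/2` and `0 < τ < 1`:
`Σ_{n ≤ x} (Σ_{d ∣ f_i(n), d > x^θ, f_i(n) ≤ d·x^τ} μ(d) log²(f_i(n)/d)) · ∏_{j≠i} Λ(f_j(n)) = o(x log x)`,
i.e. `Σ_{e ≤ x^τ} log² e · Σ_{ν} Σ_{m} μ(f_i(ν + e m)/e) · (co-weights) = o(x log x)`: Möbius cancellation
of the large complementary divisor along the `e`-derived polynomials, on average over `(e, ν)`, saving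
`(log x)²` over the trivial bound; cofactors `e ≤ exp((log x)^{1/3})` are negligible trivially and `e = 1`
(the bare atom `μ(f_i(n))`) has weight `0`. -/
theorem stub_small_cofactor :
    ∀ (k : ℕ) (f : Fin k → Polynomial ℤ) (i : Fin k),
      Literature.NumberTheory.Sieve.IsBatemanHornSystem f →
      ∀ θ : ℝ, 0 < θ → θ < 1 / 2 → ∀ τ : ℝ, 0 < τ → τ < 1 →
        Asymptotics.IsLittleO Filter.atTop
          (fun x : ℕ => ∑ n ∈ Finset.Icc 1 x,
            (∑ d ∈ (((f i).eval (n : ℤ)).toNat).divisors,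
              if (x : ℝ) ^ θ < (d : ℝ) ∧
                  ((((f i).eval (n : ℤ)).toNat : ℕ) : ℝ) ≤ (d : ℝ) * (x : ℝ) ^ τ then
                ((ArithmeticFunction.moebius d : ℤ) : ℝ) *
                  Real.log ((((f i).eval (n : ℤ)).toNat / d : ℕ) : ℝ) ^ 2
              else 0) *
            ∏ j ∈ Finset.univ.erase i, ArithmeticFunction.vonMangoldt (((f j).eval (n : ℤ)).toNat))
          (fun x : ℕ => (x : ℝ) * Real.log x) := by
  sorry

/-- **Stub 3 — both-large stratum for some admissible cut.** For every Bateman–Horn system `f` and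
index `i` there are `0 < θ < 1/2` and `0 < τ < 1` with
`Σ_{n ≤ x} (Σ_{d ∣ f_i(n), d > x^θ, d·x^τ < f_i(n)} μ(d) log²(f_i(n)/d)) · ∏_{j≠i} Λ(f_j(n)) = o(x log x)`:
divisor beyond the level AND cofactor `> x^τ`. Eventually empty for a linear `f_i` when `θ + τ ≥ 1`;
for `deg f_i = 2` it is the balanced window `f_i(n) = d·e`, `d, e ≍ x^{1∓}` with weight `μ(d) log² e`
(de la Bretèche–Drappeau level `x^{1+δ}` along quadratic values + Ford divisor-window density);
for `deg f_i ≥ 3` a genuine large stratum with no Type-I handle on either factor. -/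
theorem stub_large_cofactor :
    ∀ (k : ℕ) (f : Fin k → Polynomial ℤ) (i : Fin k),
      Literature.NumberTheory.Sieve.IsBatemanHornSystem f →
      ∃ θ : ℝ, 0 < θ ∧ θ < 1 / 2 ∧ ∃ τ : ℝ, 0 < τ ∧ τ < 1 ∧
        Asymptotics.IsLittleO Filter.atTop
          (fun x : ℕ => ∑ n ∈ Finset.Icc 1 x,
            (∑ d ∈ (((f i).eval (n : ℤ)).toNat).divisors,
              if (x : ℝ) ^ θ < (d : ℝ) ∧
                  (d : ℝ) * (x : ℝ) ^ τ < ((((f i).eval (n : ℤ)).toNat : ℕ) : ℝ) then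
                ((ArithmeticFunction.moebius d : ℤ) : ℝ) *
                  Real.log ((((f i).eval (n : ℤ)).toNat / d : ℕ) : ℝ) ^ 2
              else 0) *
            ∏ j ∈ Finset.univ.erase i, ArithmeticFunction.vonMangoldt (((f j).eval (n : ℤ)).toNat))
          (fun x : ℕ => (x : ℝ) * Real.log x) := by
  sorry

/-! ## Sorry-free glue -/

/-- Selberg's identity in the crux's spelling: `Λ(m) log m + Σ_{a ∣ m} Λ(a) Λ(m/a) = Σ_{d ∣ m} μ(d) log²(m/d)`
(`Λ₂ = Λ₁·log + Λ ⋆ Λ₁ = μ ⋆ log²`, tree lemmas `generalizedVonMangoldt_succ_apply`,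
`generalizedVonMangoldt_one`, `generalizedVonMangoldt_apply`). -/
theorem selberg_identity (m : ℕ) :
    Λ m * Real.log (m : ℝ) + ∑ a ∈ m.divisors, Λ a * Λ (m / a) =
      ∑ d ∈ m.divisors, ((μ d : ℤ) : ℝ) * Real.log ((m / d : ℕ) : ℝ) ^ 2 := by
  have h1 := Literature.NumberTheory.Sieve.generalizedVonMangoldt_succ_apply 1 m
  have h2 := Literature.NumberTheory.Sieve.generalizedVonMangoldt_apply (k := 1 + 1) (by norm_num) m
  rw [h1, Literature.NumberTheory.Sieve.generalizedVonMangoldt_one,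
    Nat.sum_divisorsAntidiagonal (fun a b => Λ a * Λ b),
    Nat.sum_divisorsAntidiagonal (fun a b => ((μ a : ℤ) : ℝ) * Real.log (b : ℝ) ^ (1 + 1))] at h2
  refine h2.trans ?_
  norm_num

/-- Trichotomy of the divisor sum: level cut at `A`, then cofactor cut at `B`. -/
theorem divisor_sum_trichotomy (m : ℕ) (A B : ℝ) :
    ∑ d ∈ m.divisors, ((μ d : ℤ) : ℝ) * Real.log ((m / d : ℕ) : ℝ) ^ 2 =
      (∑ d ∈ m.divisors,
          if (d : ℝ) ≤ A then ((μ d : ℤ) : ℝ) * Real.log ((m / d : ℕ) : ℝ) ^ 2 else 0) +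
        ((∑ d ∈ m.divisors,
            if A < (d : ℝ) ∧ ((m : ℕ) : ℝ) ≤ (d : ℝ) * B then
              ((μ d : ℤ) : ℝ) * Real.log ((m / d : ℕ) : ℝ) ^ 2 else 0) +
          (∑ d ∈ m.divisors,
            if A < (d : ℝ) ∧ (d : ℝ) * B < ((m : ℕ) : ℝ) then
              ((μ d : ℤ) : ℝ) * Real.log ((m / d : ℕ) : ℝ) ^ 2 else 0)) := by
  rw [← Finset.sum_add_distrib, ← Finset.sum_add_distrib]
  refine Finset.sum_congr rfl fun d _ => ?_
  by_cases h1 : (d : ℝ) ≤ A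
  · have h1' : ¬ (A < (d : ℝ)) := not_lt.mpr h1
    simp [h1, h1']
  · have h1' : A < (d : ℝ) := not_le.mp h1
    by_cases h2 : ((m : ℕ) : ℝ) ≤ (d : ℝ) * B
    · have h2' : ¬ ((d : ℝ) * B < ((m : ℕ) : ℝ)) := not_lt.mpr h2
      simp [h1, h1', h2, h2']
    · have h2' : (d : ℝ) * B < ((m : ℕ) : ℝ) := not_le.mp h2
      simp [h1, h1', h2, h2']

/-- **The composition, sorry-free.** Type-I main term + small-cofactor tail + large-cofactor tail
give the Λ₂-lift asymptotic (the crux, unfolded). Uses `C(f) > 0`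
(`IsBatemanHornSystem.hasBatemanHornConst_holds`) and `deg f_i ≥ 1` (`IsBatemanHornSystem.natDegree_pos`)
to compare `x log x` with the target. -/
theorem lambdaTwoLift_of_pieces
    (hMainAll : ∀ (k : ℕ) (f : Fin k → Polynomial ℤ) (i : Fin k),
      Literature.NumberTheory.Sieve.IsBatemanHornSystem f →
      ∀ θ : ℝ, 0 < θ → θ < 1 / 2 →
        Asymptotics.IsEquivalent Filter.atTop
          (fun x : ℕ => ∑ n ∈ Finset.Icc 1 x,
            (∑ d ∈ (((f i).eval (n : ℤ)).toNat).divisors,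
              if (d : ℝ) ≤ (x : ℝ) ^ θ then
                ((ArithmeticFunction.moebius d : ℤ) : ℝ) *
                  Real.log ((((f i).eval (n : ℤ)).toNat / d : ℕ) : ℝ) ^ 2
              else 0) *
            ∏ j ∈ Finset.univ.erase i, ArithmeticFunction.vonMangoldt (((f j).eval (n : ℤ)).toNat))
          (fun x : ℕ => 2 * ((f i).natDegree : ℝ) *
            Literature.NumberTheory.Sieve.batemanHornConst f * (x : ℝ) * Real.log x))
    (hSmallAll : ∀ (k : ℕ) (f : Fin k → Polynomial ℤ) (i : Fin k),
      Literature.NumberTheory.Sieve.IsBatemanHornSystem f →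
      ∀ θ : ℝ, 0 < θ → θ < 1 / 2 → ∀ τ : ℝ, 0 < τ → τ < 1 →
        Asymptotics.IsLittleO Filter.atTop
          (fun x : ℕ => ∑ n ∈ Finset.Icc 1 x,
            (∑ d ∈ (((f i).eval (n : ℤ)).toNat).divisors,
              if (x : ℝ) ^ θ < (d : ℝ) ∧
                  ((((f i).eval (n : ℤ)).toNat : ℕ) : ℝ) ≤ (d : ℝ) * (x : ℝ) ^ τ then
                ((ArithmeticFunction.moebius d : ℤ) : ℝ) *
                  Real.log ((((f i).eval (n : ℤ)).toNat / d : ℕ) : ℝ) ^ 2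
              else 0) *
            ∏ j ∈ Finset.univ.erase i, ArithmeticFunction.vonMangoldt (((f j).eval (n : ℤ)).toNat))
          (fun x : ℕ => (x : ℝ) * Real.log x))
    (hLargeAll : ∀ (k : ℕ) (f : Fin k → Polynomial ℤ) (i : Fin k),
      Literature.NumberTheory.Sieve.IsBatemanHornSystem f →
      ∃ θ : ℝ, 0 < θ ∧ θ < 1 / 2 ∧ ∃ τ : ℝ, 0 < τ ∧ τ < 1 ∧
        Asymptotics.IsLittleO Filter.atTop
          (fun x : ℕ => ∑ n ∈ Finset.Icc 1 x,
            (∑ d ∈ (((f i).eval (n : ℤ)).toNat).divisors,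
              if (x : ℝ) ^ θ < (d : ℝ) ∧
                  (d : ℝ) * (x : ℝ) ^ τ < ((((f i).eval (n : ℤ)).toNat : ℕ) : ℝ) then
                ((ArithmeticFunction.moebius d : ℤ) : ℝ) *
                  Real.log ((((f i).eval (n : ℤ)).toNat / d : ℕ) : ℝ) ^ 2
              else 0) *
            ∏ j ∈ Finset.univ.erase i, ArithmeticFunction.vonMangoldt (((f j).eval (n : ℤ)).toNat))
          (fun x : ℕ => (x : ℝ) * Real.log x)) :
    ∀ (k : ℕ) (f : Fin k → Polynomial ℤ) (i : Fin k),
      Literature.NumberTheory.Sieve.IsBatemanHornSystem f →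
        Asymptotics.IsEquivalent Filter.atTop
          (fun x : ℕ => ∑ n ∈ Finset.Icc 1 x,
            (ArithmeticFunction.vonMangoldt (((f i).eval (n : ℤ)).toNat) *
                Real.log (((f i).eval (n : ℤ)).toNat) +
              ∑ a ∈ (((f i).eval (n : ℤ)).toNat).divisors,
                ArithmeticFunction.vonMangoldt a *
                  ArithmeticFunction.vonMangoldt ((((f i).eval (n : ℤ)).toNat) / a)) *
            ∏ j ∈ Finset.univ.erase i, ArithmeticFunction.vonMangoldt (((f j).eval (n : ℤ)).toNat))
          (fun x : ℕ => 2 * ((f i).natDegree : ℝ) *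
            Literature.NumberTheory.Sieve.batemanHornConst f * (x : ℝ) * Real.log x) := by
  intro k f i hf
  obtain ⟨θ, hθ0, hθ1, τ, hτ0, hτ1, hLarge⟩ := hLargeAll k f i hf
  have hMain := hMainAll k f i hf θ hθ0 hθ1
  have hSmall := hSmallAll k f i hf θ hθ0 hθ1 τ hτ0 hτ1
  -- the target dominates `x log x`: `C(f) > 0` and `deg f_i ≥ 1`
  have hdeg : (0 : ℝ) < ((f i).natDegree : ℝ) := Nat.cast_pos.mpr (hf.natDegree_pos i)
  have hC : 0 < Literature.NumberTheory.Sieve.batemanHornConst f :=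
    (Literature.NumberTheory.Sieve.IsBatemanHornSystem.hasBatemanHornConst_holds hf).2
  have hc : (2 * ((f i).natDegree : ℝ) * Literature.NumberTheory.Sieve.batemanHornConst f) ≠ 0 :=
    (mul_pos (mul_pos two_pos hdeg) hC).ne'
  have hbig : Asymptotics.IsBigO Filter.atTop (fun x : ℕ => (x : ℝ) * Real.log x)
      (fun x : ℕ => 2 * ((f i).natDegree : ℝ) *
        Literature.NumberTheory.Sieve.batemanHornConst f * (x : ℝ) * Real.log x) :=
    (Asymptotics.isBigO_self_const_mul hc (fun x : ℕ => (x : ℝ) * Real.log x)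
      Filter.atTop).congr_right fun x => by ring
  have hsum := hMain.add_isLittleO ((hSmall.trans_isBigO hbig).add (hLarge.trans_isBigO hbig))
  refine hsum.congr_left (Filter.Eventually.of_forall fun x => ?_)
  simp only [Pi.add_apply]
  rw [← Finset.sum_add_distrib, ← Finset.sum_add_distrib]
  refine Finset.sum_congr rfl fun n _ => ?_
  rw [selberg_identity, divisor_sum_trichotomy _ ((x : ℝ) ^ θ) ((x : ℝ) ^ τ)]
  ring

/-! ## The skeleton theorem: concludes the crux BY NAME -/

/-- **Skeleton.** `LambdaTwoLift` from the three stubs (sorries live only in `stub_*`). -/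
theorem LambdaTwoLift_of : Summit.Parity.BatemanHorn.Theses.SelbergLift.LambdaTwoLift :=
  lambdaTwoLift_of_pieces stub_typeI_main stub_small_cofactor stub_large_cofactor

end Summit.Parity.BatemanHorn.Cruxes.LambdaTwoLift.Birth
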